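import Summits.CriticalPhenomena.Ising3D.TaylorGerm
import Summits.CriticalPhenomena.Ising3D.Control2DTermwise
import Literature.MathematicalPhysics.QuantumFieldTheory.ConformalBootstrap3D.BlockConjugationSymmetry
import Mathlib.Analysis.Analytic.Binomial
import Mathlib.RingTheory.Binomial
import Mathlib.Analysis.Normed.Ring.InfiniteSum
import Mathlib.Tactic.Linarith
import Mathlib.Tactic.Positivity
import Mathlib.Tactic.Ring
import Mathlib.Tactic.FieldSimp
import HarnessLib

/-!
# One-variable Taylor germs of `t^α`, `(1-t)^α` and their products, with UNIFORM majorants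
(cell `pub-ising3x`, seat boot-1; gate (g0) of the M3-γ milestone, part 3a: the elementary
one-variable input for the germs of the conformal-block terms)

HONEST FRAMING: lottery ticket; floor = tightest certified 3D Ising CFT bounds; no exact-solution
claim without a proof.

The block terms of the `σ–ε` sum rules are `(1-z)^s (1-z̄)^s (z z̄)^τ K(z,z̄)` and
`(z z̄)^s ((1-z)(1-z̄))^τ K(1-z,1-z̄)` with `K` a double power series and `τ = (Δ-ℓ)/2 ≥ 0`
UNBOUNDED over the spectrum. Their Taylor germs at `(x₀, y₀)` are assembled (part 3b) from the
one-variable germs proved here: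
* `HasGerm1 u x₀ r c` — `u(x₀+h) = ∑ c_i h^i` absolutely for `|h| < r`;
* `hasGerm1_rpow` / `hasGerm1_oneSub_rpow` — germs of `t^α` at `x₀ > 0` (radius `x₀`) and of
  `(1-t)^α` at `x₀ < 1` (radius `1-x₀`), from the tree's binomial series `hasSum_oneSubRpowCoeff`;
* `abs_choose_le_choose_add` — `|C(α,n)| ≤ C(α+n-1,n)` for `α ≥ 0` (via `|(α-n+1)_n| ≤ (α)_n`),
  hence the majorants UNIFORM IN THE EXPONENT: `∑ |c_i| t^i ≤ (x₀²/(x₀-t))^α` for `t^α`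
  (`tsum_abs_rpowGerm_le`) and `≤ ((1-x₀)²/(1-x₀-t))^α` for `(1-t)^α`, using Mathlib's
  `Real.one_div_one_sub_rpow_hasFPowerSeriesOnBall_zero` (`∑ C(α+n-1,n) y^n = (1-y)^{-α}`);
* `HasGerm1.mul` — Cauchy product of germs, majorant = product of majorants.
Sources: elementary (binomial series; Mathlib `Ring.choose`, `ascPochhammer`,
`tsum_mul_tsum_eq_tsum_sum_antidiagonal_of_summable_norm`).
-/

namespace Summit.CriticalPhenomena.Ising3D

open Finset
open Literature.MathematicalPhysics.QuantumFieldTheory.ConformalBootstrap3D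

/-! ### One-variable germs -/

/-- `HasGerm1 u x₀ r c`: `r > 0` and `u (x₀ + h) = ∑_i c_i h^i` absolutely for `|h| < r`.
[folklore] -/
def HasGerm1 (u : ℝ → ℝ) (x₀ r : ℝ) (c : ℕ → ℝ) : Prop :=
  0 < r ∧ ∀ h : ℝ, |h| < r →
    Summable (fun i => |c i| * |h| ^ i) ∧ HasSum (fun i => c i * h ^ i) (u (x₀ + h))

namespace HasGerm1

variable {u v : ℝ → ℝ} {x₀ r : ℝ} {c d : ℕ → ℝ}

/-- Absolute summability at every `0 ≤ t < r`. [folklore] -/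
theorem summable_abs (hu : HasGerm1 u x₀ r c) {t : ℝ} (ht0 : 0 ≤ t) (htr : t < r) :
    Summable (fun i => |c i| * t ^ i) := by
  have h := (hu.2 t (by rwa [abs_of_nonneg ht0])).1
  rwa [abs_of_nonneg ht0] at h

/-- The expansion. [folklore] -/
theorem hasSum (hu : HasGerm1 u x₀ r c) {h : ℝ} (hh : |h| < r) :
    HasSum (fun i => c i * h ^ i) (u (x₀ + h)) :=
  (hu.2 h hh).2

/-- Summable norms of the terms (for the Cauchy-product lemmas). [folklore] -/
theorem summable_norm (hu : HasGerm1 u x₀ r c) {h : ℝ} (hh : |h| < r) :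
    Summable (fun i => ‖c i * h ^ i‖) := by
  simpa only [Real.norm_eq_abs, abs_mul, abs_pow] using (hu.2 h hh).1

/-- **Cauchy product of germs**: `u·v` has the germ `n ↦ ∑_{i+j=n} c_i d_j`. [folklore] -/
theorem mul (hu : HasGerm1 u x₀ r c) (hv : HasGerm1 v x₀ r d) :
    HasGerm1 (fun t => u t * v t) x₀ r (fun n => ∑ ij ∈ antidiagonal n, c ij.1 * d ij.2) := by
  refine ⟨hu.1, fun h hh => ⟨?_, ?_⟩⟩
  · -- absolute summability: compare with the Cauchy product of the absolute families
    have ha := summable_norm_sum_mul_antidiagonal_of_summable_norm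
      (f := fun i => |c i| * |h| ^ i) (g := fun j => |d j| * |h| ^ j)
      (by simpa only [Real.norm_eq_abs, abs_mul, abs_abs, abs_pow] using (hu.2 h hh).1)
      (by simpa only [Real.norm_eq_abs, abs_mul, abs_abs, abs_pow] using (hv.2 h hh).1)
    refine (ha.of_norm).of_nonneg_of_le (fun n => by positivity) fun n => ?_
    calc |∑ ij ∈ antidiagonal n, c ij.1 * d ij.2| * |h| ^ n
        ≤ (∑ ij ∈ antidiagonal n, |c ij.1 * d ij.2|) * |h| ^ n :=
          mul_le_mul_of_nonneg_right (abs_sum_le_sum_abs _ _) (pow_nonneg (abs_nonneg _) _)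
      _ = ∑ ij ∈ antidiagonal n, |c ij.1| * |h| ^ ij.1 * (|d ij.2| * |h| ^ ij.2) := by
          rw [Finset.sum_mul]
          refine Finset.sum_congr rfl fun ij hij => ?_
          rw [← mem_antidiagonal.mp hij, pow_add, abs_mul]
          ring
  · have hprod := tsum_mul_tsum_eq_tsum_sum_antidiagonal_of_summable_norm
      (hu.summable_norm hh) (hv.summable_norm hh)
    rw [(hu.hasSum hh).tsum_eq, (hv.hasSum hh).tsum_eq] at hprod
    have hs : Summable fun n => ∑ ij ∈ antidiagonal n, c ij.1 * h ^ ij.1 * (d ij.2 * h ^ ij.2) :=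
      (summable_norm_sum_mul_antidiagonal_of_summable_norm (hu.summable_norm hh)
        (hv.summable_norm hh)).of_norm
    have h1 := hs.hasSum
    rw [← hprod] at h1
    refine h1.congr_fun fun n => ?_
    rw [Finset.sum_mul]
    refine Finset.sum_congr rfl fun ij hij => ?_
    rw [← mem_antidiagonal.mp hij, pow_add]
    ring

/-- Majorant of the Cauchy product: `∑ |e_n| t^n ≤ (∑ |c_i| t^i)(∑ |d_j| t^j)`. [folklore] -/
theorem tsum_abs_mul_le (hu : HasGerm1 u x₀ r c) (hv : HasGerm1 v x₀ r d) {t : ℝ} (ht0 : 0 ≤ t)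
    (htr : t < r) :
    ∑' n, |∑ ij ∈ antidiagonal n, c ij.1 * d ij.2| * t ^ n ≤
      (∑' i, |c i| * t ^ i) * ∑' j, |d j| * t ^ j := by
  have ht : |t| < r := by rwa [abs_of_nonneg ht0]
  have hcn : Summable fun i => ‖|c i| * t ^ i‖ := by
    simpa only [Real.norm_eq_abs, abs_mul, abs_abs, abs_pow, abs_of_nonneg ht0]
      using hu.summable_abs ht0 htr
  have hdn : Summable fun j => ‖|d j| * t ^ j‖ := by
    simpa only [Real.norm_eq_abs, abs_mul, abs_abs, abs_pow, abs_of_nonneg ht0]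
      using hv.summable_abs ht0 htr
  rw [tsum_mul_tsum_eq_tsum_sum_antidiagonal_of_summable_norm hcn hdn]
  have hs := (summable_norm_sum_mul_antidiagonal_of_summable_norm hcn hdn).of_norm
  refine ((hu.mul hv).summable_abs ht0 htr).tsum_le_tsum (fun n => ?_) hs
  calc |∑ ij ∈ antidiagonal n, c ij.1 * d ij.2| * t ^ n
      ≤ (∑ ij ∈ antidiagonal n, |c ij.1 * d ij.2|) * t ^ n :=
        mul_le_mul_of_nonneg_right (abs_sum_le_sum_abs _ _) (pow_nonneg ht0 _)
    _ = ∑ ij ∈ antidiagonal n, |c ij.1| * t ^ ij.1 * (|d ij.2| * t ^ ij.2) := by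
        rw [Finset.sum_mul]
        refine Finset.sum_congr rfl fun ij hij => ?_
        rw [← mem_antidiagonal.mp hij, pow_add, abs_mul]
        ring

end HasGerm1

/-! ### The germs of `t^α` and `(1-t)^α` -/

/-- Coefficients of `t^α` at `x₀`: `x₀^α C(α,i) x₀^{-i}` written with the tree's
`oneSubRpowCoeff α i = (-1)^i C(α,i)`. [folklore] -/
noncomputable def rpowGerm (α x₀ : ℝ) (i : ℕ) : ℝ :=
  x₀ ^ α * oneSubRpowCoeff α i * (-x₀⁻¹) ^ i

/-- Coefficients of `(1-t)^α` at `x₀`: `(1-x₀)^α (-1)^i C(α,i) (1-x₀)^{-i}`. [folklore] -/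
noncomputable def oneSubGerm (α x₀ : ℝ) (i : ℕ) : ℝ :=
  (1 - x₀) ^ α * oneSubRpowCoeff α i * ((1 - x₀)⁻¹) ^ i

/-- **Germ of `t^α` at `x₀ > 0`**, radius `x₀`: `(x₀+h)^α = x₀^α (1 - (-h/x₀))^α`. [folklore] -/
theorem hasGerm1_rpow (α : ℝ) {x₀ : ℝ} (hx : 0 < x₀) :
    HasGerm1 (fun t => t ^ α) x₀ x₀ (rpowGerm α x₀) := by
  refine ⟨hx, fun h hh => ⟨?_, ?_⟩⟩
  · have hy : |h| / x₀ < 1 := (div_lt_one hx).mpr hh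
    refine ((summable_abs_oneSubRpowCoeff α (div_nonneg (abs_nonneg h) hx.le) hy).mul_left
      (x₀ ^ α)).congr fun i => ?_
    rw [rpowGerm, abs_mul, abs_mul, abs_of_nonneg (Real.rpow_nonneg hx.le _), abs_pow, abs_neg,
      abs_inv, abs_of_pos hx, div_pow, inv_pow]
    ring
  · have hy : |(-h / x₀)| < 1 := by
      rw [abs_div, abs_neg, abs_of_pos hx]; exact (div_lt_one hx).mpr hh
    have hs := (hasSum_oneSubRpowCoeff α hy).mul_left (x₀ ^ α)
    have hval : x₀ ^ α * (1 - -h / x₀) ^ α = (x₀ + h) ^ α := by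
      rw [← Real.mul_rpow hx.le (by
        have : -x₀ < h := by rw [abs_lt] at hh; linarith
        have hlt : -h / x₀ < 1 := (div_lt_one hx).mpr (by linarith)
        linarith)]
      congr 1
      field_simp
      ring
    rw [hval] at hs
    refine hs.congr_fun fun i => ?_
    rw [rpowGerm, div_eq_mul_inv, show -h * x₀⁻¹ = (-x₀⁻¹) * h by ring, mul_pow]
    ring

/-- **Germ of `(1-t)^α` at `x₀ < 1`**, radius `1-x₀`: `(1-x₀-h)^α = (1-x₀)^α (1 - h/(1-x₀))^α`.
[folklore] -/
theorem hasGerm1_oneSub_rpow (α : ℝ) {x₀ : ℝ} (hx : x₀ < 1) :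
    HasGerm1 (fun t => (1 - t) ^ α) x₀ (1 - x₀) (oneSubGerm α x₀) := by
  have hx' : 0 < 1 - x₀ := by linarith
  refine ⟨hx', fun h hh => ⟨?_, ?_⟩⟩
  · have hy : |h| / (1 - x₀) < 1 := (div_lt_one hx').mpr hh
    refine ((summable_abs_oneSubRpowCoeff α (div_nonneg (abs_nonneg h) hx'.le) hy).mul_left
      ((1 - x₀) ^ α)).congr fun i => ?_
    rw [oneSubGerm, abs_mul, abs_mul, abs_of_nonneg (Real.rpow_nonneg hx'.le _), abs_pow,
      abs_inv, abs_of_pos hx', div_pow, inv_pow]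
    ring
  · have hy : |h / (1 - x₀)| < 1 := by
      rw [abs_div, abs_of_pos hx']; exact (div_lt_one hx').mpr hh
    have hs := (hasSum_oneSubRpowCoeff α hy).mul_left ((1 - x₀) ^ α)
    have hval : (1 - x₀) ^ α * (1 - h / (1 - x₀)) ^ α = (1 - (x₀ + h)) ^ α := by
      rw [← Real.mul_rpow hx'.le (by
        have : h < 1 - x₀ := by rw [abs_lt] at hh; linarith
        have hlt : h / (1 - x₀) < 1 := (div_lt_one hx').mpr this
        linarith)]
      congr 1
      field_simp
      ring
    rw [hval] at hs
    refine hs.congr_fun fun i => ?_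
    rw [oneSubGerm, div_eq_mul_inv, mul_pow]
    ring

/-! ### The exponent-uniform majorant: `|C(α,n)| ≤ C(α+n-1,n)` for `α ≥ 0` -/

/-- `|(τ-n+1)_n| ≤ (τ)_n` for `τ ≥ 0`: each factor `|τ-n+1+j| ≤ τ+j'` after reversing the order
(`(x)_{n+1} = x (x+1)_n` against `(τ)_{n+1} = (τ)_n (τ+n)`). [folklore] -/
theorem abs_ascPochhammer_eval_sub_le {τ : ℝ} (hτ : 0 ≤ τ) (n : ℕ) :
    |(ascPochhammer ℝ n).eval (τ - n + 1)| ≤ (ascPochhammer ℝ n).eval τ := by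
  induction n generalizing τ with
  | zero => simp
  | succ n ih =>
    have hleft : (ascPochhammer ℝ (n + 1)).eval (τ - (n + 1 : ℕ) + 1) =
        (τ - n) * (ascPochhammer ℝ n).eval (τ - n + 1) := by
      rw [ascPochhammer_succ_left, Polynomial.eval_mul, Polynomial.eval_X, Polynomial.eval_comp,
        Polynomial.eval_add, Polynomial.eval_X, Polynomial.eval_one]
      push_cast
      ring_nf
    rw [hleft, ascPochhammer_succ_eval, abs_mul]
    have h1 : |τ - n| ≤ τ + n := abs_sub_le_iff.mpr ⟨by linarith [n.cast_nonneg (α := ℝ)],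
      by linarith [n.cast_nonneg (α := ℝ)]⟩
    have h2 := ih hτ
    have h3 : 0 ≤ (ascPochhammer ℝ n).eval τ := Control2D.ascPochhammer_eval_nonneg n hτ
    calc |τ - ↑n| * |(ascPochhammer ℝ n).eval (τ - ↑n + 1)|
        ≤ (τ + n) * (ascPochhammer ℝ n).eval τ := mul_le_mul h1 h2 (abs_nonneg _) (by positivity)
      _ = (ascPochhammer ℝ n).eval τ * (τ + n) := mul_comm _ _

/-- `Ring.choose` over `ℝ` through the ascending Pochhammer symbol:
`C(a,n) = (a-n+1)_n / n!`. [folklore] -/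
theorem choose_eq_ascPochhammer_div (a : ℝ) (n : ℕ) :
    Ring.choose a n = (ascPochhammer ℝ n).eval (a - n + 1) / (n.factorial : ℝ) := by
  rw [Ring.choose_eq_smul, Polynomial.descPochhammer_smeval_eq_ascPochhammer,
    Polynomial.ascPochhammer_smeval_eq_eval, smul_eq_mul, div_eq_inv_mul]

/-- **`|C(α,n)| ≤ C(α+n-1,n)` for `α ≥ 0`.** [folklore] -/
theorem abs_choose_le_choose_add {α : ℝ} (hα : 0 ≤ α) (n : ℕ) :
    |Ring.choose α n| ≤ Ring.choose (α + n - 1) n := by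
  rw [choose_eq_ascPochhammer_div, choose_eq_ascPochhammer_div, abs_div,
    abs_of_pos (by positivity : (0 : ℝ) < n.factorial),
    show α + (n : ℝ) - 1 - n + 1 = α by ring]
  exact div_le_div_of_nonneg_right (abs_ascPochhammer_eval_sub_le hα n) (by positivity)

/-- `∑_n C(α+n-1,n) y^n = (1-y)^{-α}` for `|y| < 1` (Mathlib's
`Real.one_div_one_sub_rpow_hasFPowerSeriesOnBall_zero`). [folklore] -/
theorem hasSum_choose_add_mul_pow (α : ℝ) {y : ℝ} (hy : |y| < 1) :
    HasSum (fun n : ℕ => Ring.choose (α + (n : ℝ) - 1) n * y ^ n) (1 / (1 - y) ^ α) := by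
  have hmem : y ∈ Metric.eball (0 : ℝ) 1 := by
    rw [← ENNReal.ofReal_one, Metric.eball_ofReal, Metric.mem_ball, dist_zero_right,
      Real.norm_eq_abs]
    exact hy
  have h := (Real.one_div_one_sub_rpow_hasFPowerSeriesOnBall_zero α).hasSum hmem
  have ht : (fun n : ℕ => (FormalMultilinearSeries.ofScalars ℝ fun m : ℕ ↦
      Ring.choose (α + (m : ℝ) - 1) m) n fun _ => y) =
      fun n : ℕ => Ring.choose (α + (n : ℝ) - 1) n * y ^ n := by
    funext n
    rw [FormalMultilinearSeries.ofScalars_apply_eq, smul_eq_mul]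
  rw [ht, zero_add] at h
  exact h

/-- **Uniform majorant of the binomial coefficients' absolute series**: for `α ≥ 0`, `0 ≤ y < 1`,
`∑_i |C(α,i)| y^i ≤ (1-y)^{-α}`. [folklore] -/
theorem tsum_abs_oneSubRpowCoeff_le {α : ℝ} (hα : 0 ≤ α) {y : ℝ} (hy0 : 0 ≤ y) (hy1 : y < 1) :
    ∑' i, |oneSubRpowCoeff α i| * y ^ i ≤ 1 / (1 - y) ^ α := by
  have hy : |y| < 1 := by rwa [abs_of_nonneg hy0]
  refine hasSum_le (fun i => ?_) (summable_abs_oneSubRpowCoeff α hy0 hy1).hasSum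
    (hasSum_choose_add_mul_pow α hy)
  refine mul_le_mul_of_nonneg_right ?_ (pow_nonneg hy0 _)
  rw [oneSubRpowCoeff, abs_mul, abs_pow, abs_neg, abs_one, one_pow, one_mul]
  exact abs_choose_le_choose_add hα i

/-- **Majorant of the germ of `t^α`**, uniform in `α ≥ 0`: for `0 ≤ t < x₀`,
`∑_i |rpowGerm α x₀ i| t^i ≤ (x₀² / (x₀ - t))^α`. [folklore] -/
theorem tsum_abs_rpowGerm_le {α : ℝ} (hα : 0 ≤ α) {x₀ t : ℝ} (hx : 0 < x₀) (ht0 : 0 ≤ t)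
    (ht : t < x₀) : ∑' i, |rpowGerm α x₀ i| * t ^ i ≤ (x₀ ^ 2 / (x₀ - t)) ^ α := by
  have hy0 : 0 ≤ t / x₀ := div_nonneg ht0 hx.le
  have hy1 : t / x₀ < 1 := (div_lt_one hx).mpr ht
  have hterm : ∀ i, |rpowGerm α x₀ i| * t ^ i = x₀ ^ α * (|oneSubRpowCoeff α i| * (t / x₀) ^ i) := by
    intro i
    rw [rpowGerm, abs_mul, abs_mul, abs_of_nonneg (Real.rpow_nonneg hx.le _), abs_pow, abs_neg,
      abs_inv, abs_of_pos hx, div_pow, inv_pow]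
    ring
  simp only [hterm]
  rw [tsum_mul_left]
  have h1 := tsum_abs_oneSubRpowCoeff_le hα hy0 hy1
  have h2 : x₀ ^ α * (1 / (1 - t / x₀) ^ α) = (x₀ ^ 2 / (x₀ - t)) ^ α := by
    have hpos : 0 < 1 - t / x₀ := by linarith
    rw [one_div, ← Real.inv_rpow hpos.le, ← Real.mul_rpow hx.le (inv_nonneg.mpr hpos.le)]
    congr 1
    field_simp
  calc x₀ ^ α * ∑' i, |oneSubRpowCoeff α i| * (t / x₀) ^ i ≤ x₀ ^ α * (1 / (1 - t / x₀) ^ α) :=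
        mul_le_mul_of_nonneg_left h1 (Real.rpow_nonneg hx.le _)
    _ = _ := h2

/-- **Majorant of the germ of `(1-t)^α`**, uniform in `α ≥ 0`: for `0 ≤ t < 1 - x₀`,
`∑_i |oneSubGerm α x₀ i| t^i ≤ ((1-x₀)² / (1-x₀-t))^α`. [folklore] -/
theorem tsum_abs_oneSubGerm_le {α : ℝ} (hα : 0 ≤ α) {x₀ t : ℝ} (hx : x₀ < 1) (ht0 : 0 ≤ t)
    (ht : t < 1 - x₀) : ∑' i, |oneSubGerm α x₀ i| * t ^ i ≤ ((1 - x₀) ^ 2 / (1 - x₀ - t)) ^ α := by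
  have hx' : 0 < 1 - x₀ := by linarith
  have hterm : ∀ i, oneSubGerm α x₀ i = rpowGerm α (1 - x₀) i * (-1) ^ i := by
    intro i
    have hp : (-(1 - x₀)⁻¹) ^ i * (-1) ^ i = ((1 - x₀)⁻¹) ^ i := by
      rw [← mul_pow]; congr 1; ring
    conv_rhs => rw [rpowGerm, mul_assoc, hp]
    rfl
  have habs : ∀ i, |oneSubGerm α x₀ i| * t ^ i = |rpowGerm α (1 - x₀) i| * t ^ i := by
    intro i
    rw [hterm, abs_mul, abs_pow, abs_neg, abs_one, one_pow, mul_one]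
  simp only [habs]
  have := tsum_abs_rpowGerm_le hα hx' ht0 ht
  rwa [show 1 - x₀ - t = (1 - x₀) - t by ring]

/-- A germ with general (possibly negative) exponent still has SOME finite majorant at every
`0 ≤ t < x₀` (no uniformity claimed): the external-dimension prefactors `s` are fixed.
[folklore] -/
theorem summable_abs_rpowGerm (α : ℝ) {x₀ t : ℝ} (hx : 0 < x₀) (ht0 : 0 ≤ t) (ht : t < x₀) :
    Summable (fun i => |rpowGerm α x₀ i| * t ^ i) :=
  (hasGerm1_rpow α hx).summable_abs ht0 ht

/-- Likewise for `(1-t)^α`. [folklore] -/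
theorem summable_abs_oneSubGerm (α : ℝ) {x₀ t : ℝ} (hx : x₀ < 1) (ht0 : 0 ≤ t) (ht : t < 1 - x₀) :
    Summable (fun i => |oneSubGerm α x₀ i| * t ^ i) :=
  (hasGerm1_oneSub_rpow α hx).summable_abs ht0 ht

end Summit.CriticalPhenomena.Ising3D
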